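import Mathlib
import Summits.Ventures.HodgeRepro.Tier4.Target
import Summits.Ventures.HodgeRepro.Tier4.Line3.Defs
import Summits.Ventures.HodgeRepro.Tier4.Line3.DefsLemmas
import Summits.Ventures.HodgeRepro.Tier4.Line3.GaussRatioFormula
import Summits.Ventures.HodgeRepro.Tier4.Line3.CopyRemainder
import Summits.Ventures.HodgeRepro.Tier4.Line3.CopyWeightGaussian
import Summits.Ventures.HodgeRepro.Tier4.Line3.CopyWeightBoundShrink
import Summits.Ventures.HodgeRepro.Tier4.Line3.LatticeGaussSummable
import Summits.Ventures.HodgeRepro.Tier4.Line3.CopyCountSummable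
import Summits.Ventures.HodgeRepro.Tier4.Line3.ShrinkMajGauss
import Summits.Ventures.HodgeRepro.Tier4.Line3.GaussCountRay
import Summits.Ventures.HodgeRepro.Tier4.Line3.CopyCountShrink

/-!
# Tier4/Line3/CopyCountRay — the pure count of the copies along the integer ray of a centre, under the strict profile
condition: summable, and `≤ θ₁` from some scale on

Blind re-derivation cell `pub-hodge-repro`, Tier 4 «PROVE THE STEP», LINE L3, seat t4-x2 (g3, reserve wall-breaker); the
T4Data wrapper of GaussCountRay announced on bus S14039.  Scaling the centre along the integer ray, `rayCentre xm n = n • xm`,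
multiplies every size by `n²` (`tauSize_rayCentre`, `defQuad_rayCentre`, `defSize_rayCentre`), so the shrinking majorant of
CopyWeightBoundShrink factors as

  `shrinkMaj A k ε (n • xm) = shrinkW A k ε · exp(−π n² · profileExcPlus ε xm)`   (`shrinkMaj_rayCentre`),

with the `n`-free weight `shrinkW` and the PROFILE EXPONENT `profileExcPlus ε xm = Σ_j (t_j² − 1)⁺ tauSize (xm j) + defSize ε xm`.
The representative of a non-main copy is an admissible tuple of non-zero scalars that is NOT norm-one at every slot
(`rep_mem_nonNormOne`: norm-one tuples give the main line tuple, `lineStep`).  Hence, for integral admissible scalars, a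
centre with non-zero slots, phases bounded by `Λ₀` on every copy of every scale, and the STRICT PROFILE CONDITION
`profileExcPlus ε xm > 0` on the non-norm-one admissible tuples (bus S13860 (F2)):

  **`eventually_copyCount_rayCentre`**: for every `θ > 0`, from some scale `n` on, the count over the copies of `n • xm`
  with the majorant `shrinkMaj A k (rep o) (n • xm) · ‖Λ(o)‖` is SUMMABLE and `≤ θ`

— both conjuncts of v0.44's `MajorantCount S (n • xm) (c_n.majHK A k) θ` (bus S13913).  The count over orbits is compared
with the Gaussian count over the fixed set of scalar tuples (`Summable.tsum_le_tsum_of_inj` along the representative),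
which is summable at the base scale by ShrinkMajGauss and vanishes along the ray by GaussCountRay (Tannery).  What this
does NOT decide: the profile condition itself (field-dependent; empty bad set for `m = 2` in the tree's normalisation,
proofs/t4/L3/ARCH-COPY-PROFILE-x2.md §3), and the uniformity in `n` of the (HK) constants `(A, k)` that tie the majorant
to the weights (`MajorantMomentBound D (n • xm) A k`, displayed).

Nothing here says anything about the status of the Hodge conjecture for CM abelian varieties, which is NOT proved
(HC_CM is NOT proved by anyone in this repository).
-/

set_option autoImplicit false

noncomputable section

namespace Summit.Ventures.HodgeRepro.Tier4.Line3

open Summit.Ventures.HodgeRepro.Tier4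
open Matrix NumberField Filter Topology
open scoped ComplexConjugate
open scoped Classical

namespace T4Data

variable (X : T4Data)

/-! ## 1. The integer ray of a centre -/

/-- The centre scaled by the integer `n`. -/
def rayCentre (xm : X.Tuple) (n : ℕ) : X.Tuple := fun j => (n : X.E) • xm j

/-- The base of the ray is the centre. -/
theorem rayCentre_one (xm : X.Tuple) : X.rayCentre xm 1 = xm := by
  funext j
  simp [rayCentre]

/-- The slots of `n • xm` are non-zero for `n ≥ 1`. -/
theorem rayCentre_ne_zero {xm : X.Tuple} (hx : ∀ j, xm j ≠ 0) {n : ℕ} (hn : 1 ≤ n) (j : Fin 4) :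
    X.rayCentre xm n j ≠ 0 := by
  have hn0 : (n : X.E) ≠ 0 := by exact_mod_cast (Nat.one_le_iff_ne_zero.1 hn)
  exact smul_ne_zero hn0 (hx j)

/-- The `τ₀`-size scales by `n²`. -/
theorem tauSize_rayCentre (xm : X.Tuple) (n : ℕ) (j : Fin 4) :
    X.tauSize (X.rayCentre xm n j) = (n : ℝ) ^ 2 * X.tauSize (xm j) := by
  unfold tauSize rayCentre
  rw [X.hform_smul, map_natCast, map_mul, map_mul, map_natCast, norm_mul, norm_mul, Complex.norm_natCast]
  ring

/-- The definite sizes scale by `n²`. -/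
theorem defQuad_rayCentre (σ : X.E →+* ℂ) (xm : X.Tuple) (n : ℕ) (j : Fin 4) :
    X.defQuad σ (X.rayCentre xm n j) = (n : ℝ) ^ 2 * X.defQuad σ (xm j) := by
  unfold rayCentre
  rw [X.defQuad_smul, map_natCast, Complex.norm_natCast]

/-- `defSize` scales by `n²`. -/
theorem defSize_rayCentre (ε : Fin 4 → X.E) (xm : X.Tuple) (n : ℕ) :
    X.defSize ε (X.rayCentre xm n) = (n : ℝ) ^ 2 * X.defSize ε xm := by
  unfold defSize
  rw [Finset.mul_sum]
  refine Finset.sum_congr rfl fun j _ => ?_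
  rw [Finset.mul_sum]
  refine Finset.sum_congr rfl fun σ _ => ?_
  rw [X.defQuad_rayCentre]
  ring

/-! ## 2. The `n`-free weight and the profile exponent -/

/-- The `n`-free weight of the shrinking majorant. -/
def shrinkW (A k : ℝ) (ε : Fin 4 → X.E) : ℝ :=
  A * (∏ j, ‖X.τ₀ (ε j)‖ ^ 2) * ∏ j, (min 1 (‖X.τ₀ (ε j)‖ ^ 2)) ^ (-k)

/-- **THE PROFILE EXPONENT** of the copy `ε • x`: `Σ_j (t_j² − 1)⁺ tauSize (x j) + defSize ε x`. -/
def profileExcPlus (ε : Fin 4 → X.E) (x : X.Tuple) : ℝ :=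
  (∑ j, max 0 (‖X.τ₀ (ε j)‖ ^ 2 - 1) * X.tauSize (x j)) + X.defSize ε x

/-- The weight is non-negative for `A ≥ 0`. -/
theorem shrinkW_nonneg {A : ℝ} (hA : 0 ≤ A) (k : ℝ) (ε : Fin 4 → X.E) : 0 ≤ X.shrinkW A k ε := by
  unfold shrinkW
  have h1 : 0 ≤ ∏ j, (min 1 (‖X.τ₀ (ε j)‖ ^ 2)) ^ (-k) :=
    Finset.prod_nonneg fun j _ => Real.rpow_nonneg (by positivity) _
  positivity

/-- **THE SHRINKING MAJORANT ALONG THE RAY**: `shrinkMaj A k ε (n • xm) = shrinkW A k ε · exp(−π n² profileExcPlus ε xm)`. -/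
theorem shrinkMaj_rayCentre (A k : ℝ) (ε : Fin 4 → X.E) (xm : X.Tuple) (n : ℕ) :
    X.shrinkMaj A k ε (X.rayCentre xm n) =
      X.shrinkW A k ε * Real.exp (-(Real.pi * (n : ℝ) ^ 2 * X.profileExcPlus ε xm)) := by
  unfold shrinkMaj shrinkW profileExcPlus
  rw [X.defSize_rayCentre]
  have e1 : (∑ j, max 0 (‖X.τ₀ (ε j)‖ ^ 2 - 1) * X.tauSize (X.rayCentre xm n j)) =
      (n : ℝ) ^ 2 * ∑ j, max 0 (‖X.τ₀ (ε j)‖ ^ 2 - 1) * X.tauSize (xm j) := by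
    rw [Finset.mul_sum]
    refine Finset.sum_congr rfl fun j _ => ?_
    rw [X.tauSize_rayCentre]
    ring
  rw [e1, mul_assoc, ← Real.exp_add]
  congr 1
  ring

/-- At the base scale the majorant is the weight times the Gaussian of the profile exponent. -/
theorem shrinkMaj_eq_shrinkW_mul (A k : ℝ) (ε : Fin 4 → X.E) (xm : X.Tuple) :
    X.shrinkMaj A k ε xm = X.shrinkW A k ε * Real.exp (-(Real.pi * X.profileExcPlus ε xm)) := by
  have := X.shrinkMaj_rayCentre A k ε xm 1
  rw [X.rayCentre_one] at this
  simpa using this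

/-! ## 3. The representatives of the non-main copies -/

/-- A norm-one scaling of every slot gives the same line tuple, hence the main orbit. -/
theorem orbitOf_lines_smul_eq_of_norm_one {ε : Fin 4 → X.E} (x : X.Tuple) (h : ∀ j, X.c (ε j) * ε j = 1) :
    X.orbitOf (X.lines (fun j => ε j • x j)) = X.orbitOf (X.lines x) := by
  congr 1
  funext j
  show Quot.mk X.lineStep (ε j • x j) = Quot.mk X.lineStep (x j)
  exact (Quot.sound ⟨ε j, h j, rfl⟩).symm

/-- The admissible tuples of non-zero scalars that are not norm-one at every slot. -/
def NonNormOne (S : Set (Fin 4 → X.E)) : Set (Fin 4 → X.E) :=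
  {ε | ε ∈ S ∧ (∀ j, ε j ≠ 0) ∧ ∃ j, X.c (ε j) * ε j ≠ 1}

/-- The representative of a non-main copy is a non-norm-one admissible tuple. -/
theorem rep_mem_nonNormOne {D : X.ThetaData} {S : Set (Fin 4 → X.E)} {x : X.Tuple} (c : X.CopyData D S x)
    {o : X.Orbit} (ho : o ∈ X.Copies S x) (hne : o ≠ X.orbitOf (X.lines x)) : c.rep o ∈ X.NonNormOne S := by
  refine ⟨c.rep_mem o ho, c.rep_ne o ho, ?_⟩
  by_contra hall
  have h : ∀ j, X.c (c.rep o j) * c.rep o j = 1 := fun j => by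
    by_contra hj
    exact hall ⟨j, hj⟩
  apply hne
  rw [← c.rep_orbit o ho]
  exact X.orbitOf_lines_smul_eq_of_norm_one x h

/-- The representative, as an element of the non-norm-one tuples. -/
def CopyData.nnRep {X : T4Data} {D : X.ThetaData} {S : Set (Fin 4 → X.E)} {x : X.Tuple} (c : X.CopyData D S x)
    (o : X.NonMainCopies S x) : X.NonNormOne S :=
  ⟨c.rep o.1, X.rep_mem_nonNormOne c o.2.1 o.2.2⟩

/-- `nnRep` is injective (`rep_orbit`). -/
theorem CopyData.nnRep_injective {X : T4Data} {D : X.ThetaData} {S : Set (Fin 4 → X.E)} {x : X.Tuple}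
    (c : X.CopyData D S x) : Function.Injective c.nnRep := by
  intro o o' h
  have hrep : c.rep o.1 = c.rep o'.1 := congrArg Subtype.val h
  apply Subtype.ext
  rw [← c.rep_orbit o.1 o.2.1, ← c.rep_orbit o'.1 o'.2.1, hrep]

/-! ## 4. The count along the ray -/

/-- The Gaussian count over the non-norm-one tuples at the base scale is summable (ShrinkMajGauss). -/
theorem summable_base_count {S : Set (Fin 4 → X.E)} (hS : X.IntegralScalars S) {xm : X.Tuple} (hx : ∀ j, xm j ≠ 0)
    {A k : ℝ} (hA : 0 ≤ A) (hk : 0 ≤ k) {Λ₀ : ℝ} (hΛ0 : 0 ≤ Λ₀) :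
    Summable fun ε : X.NonNormOne S => X.shrinkW A k ε.1 * Λ₀ * Real.exp (-(Real.pi * X.profileExcPlus ε.1 xm)) := by
  obtain ⟨qm, hqm, hq⟩ := X.exists_defQuad_lower xm hx
  obtain ⟨C, κ, hκ, hbound⟩ := X.shrinkMaj_le_gauss A k hA hk xm hx hqm hq
  -- the injection into the integral tuples
  let ι : X.NonNormOne S → (Fin 4 → 𝓞 X.E) := fun ε j => ⟨ε.1 j, hS _ ε.2.1 j⟩
  have hι : Function.Injective ι := by
    intro ε ε' h
    apply Subtype.ext
    funext j
    have := congrArg (fun f : Fin 4 → 𝓞 X.E => ((f j : 𝓞 X.E) : X.E)) h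
    simpa [ι] using this
  have hG : Summable fun ε : Fin 4 → 𝓞 X.E => (C * Λ₀) * Real.exp (-(κ * ∑ j, ‖mixedEmbedding X.E (ε j : X.E)‖ ^ 2)) :=
    (summable_gauss_mixedNorm_sq_tuple hκ).mul_left _
  refine Summable.of_nonneg_of_le (fun ε => ?_) (fun ε => ?_) (hG.comp_injective hι)
  · exact mul_nonneg (mul_nonneg (X.shrinkW_nonneg hA k _) hΛ0) (Real.exp_pos _).le
  · have h1 := hbound ε.1 (fun j => hS _ ε.2.1 j) ε.2.2.1
    rw [X.shrinkMaj_eq_shrinkW_mul] at h1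
    simp only [Function.comp_apply, ι]
    calc X.shrinkW A k ε.1 * Λ₀ * Real.exp (-(Real.pi * X.profileExcPlus ε.1 xm))
        = (X.shrinkW A k ε.1 * Real.exp (-(Real.pi * X.profileExcPlus ε.1 xm))) * Λ₀ := by ring
      _ ≤ (C * Real.exp (-(κ * ∑ j, ‖mixedEmbedding X.E (ε.1 j)‖ ^ 2))) * Λ₀ :=
          mul_le_mul_of_nonneg_right h1 hΛ0
      _ = (C * Λ₀) * Real.exp (-(κ * ∑ j, ‖mixedEmbedding X.E (ε.1 j)‖ ^ 2)) := by ring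

/-- **THE COUNT OVER THE COPIES OF `n • xm` IS BOUNDED BY THE GAUSSIAN COUNT OVER THE NON-NORM-ONE TUPLES** (`n ≥ 1`,
profile exponents `≥ 0`). -/
theorem copyCount_rayCentre_le {D : X.ThetaData} {S : Set (Fin 4 → X.E)} (hS : X.IntegralScalars S) {xm : X.Tuple}
    (hx : ∀ j, xm j ≠ 0) {n : ℕ} (hn : 1 ≤ n) (c : X.CopyData D S (X.rayCentre xm n)) {A k : ℝ} (hA : 0 ≤ A)
    (hk : 0 ≤ k) {Λ₀ : ℝ} (hΛ0 : 0 ≤ Λ₀)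
    (hΛ : ∀ o ∈ X.Copies S (X.rayCentre xm n), ‖c.lam o 0 * c.lam o 1 * conj (c.lam o 2 * c.lam o 3)‖ ≤ Λ₀)
    (hprof : ∀ ε ∈ X.NonNormOne S, 0 ≤ X.profileExcPlus ε xm) :
    (∑' o, if o ∈ X.Copies S (X.rayCentre xm n) ∧ o ≠ X.orbitOf (X.lines (X.rayCentre xm n)) then
      X.shrinkMaj A k (c.rep o) (X.rayCentre xm n) * ‖c.lam o 0 * c.lam o 1 * conj (c.lam o 2 * c.lam o 3)‖ else 0) ≤
    gaussCount (fun ε : X.NonNormOne S => X.shrinkW A k ε.1 * Λ₀) (fun ε => X.profileExcPlus ε.1 xm) n := by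
  -- the Gaussian count at scale `n` is summable (comparison with the base scale)
  have hbase := X.summable_base_count hS hx hA hk hΛ0 (S := S)
  have hw0 : ∀ ε : X.NonNormOne S, 0 ≤ X.shrinkW A k ε.1 * Λ₀ := fun ε => mul_nonneg (X.shrinkW_nonneg hA k _) hΛ0
  have hE0 : ∀ ε : X.NonNormOne S, 0 ≤ X.profileExcPlus ε.1 xm := fun ε => hprof ε.1 ε.2
  have hg : Summable fun ε : X.NonNormOne S =>
      X.shrinkW A k ε.1 * Λ₀ * Real.exp (-(Real.pi * (n : ℝ) ^ 2 * X.profileExcPlus ε.1 xm)) :=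
    summable_gauss_ray hw0 hE0 hbase hn
  -- the majorant of a copy against the Gaussian count at its representative
  set W : X.Orbit → ℝ := fun o => X.shrinkMaj A k (c.rep o) (X.rayCentre xm n) *
    ‖c.lam o 0 * c.lam o 1 * conj (c.lam o 2 * c.lam o 3)‖ with hW
  have hle : ∀ o : X.NonMainCopies S (X.rayCentre xm n), W o.1 ≤
      X.shrinkW A k (c.nnRep o).1 * Λ₀ * Real.exp (-(Real.pi * (n : ℝ) ^ 2 * X.profileExcPlus (c.nnRep o).1 xm)) := by
    intro o
    simp only [hW, CopyData.nnRep]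
    rw [X.shrinkMaj_rayCentre]
    have h1 := hΛ o.1 o.2.1
    have h2 : 0 ≤ X.shrinkW A k (c.rep o.1) * Real.exp (-(Real.pi * (n : ℝ) ^ 2 * X.profileExcPlus (c.rep o.1) xm)) :=
      mul_nonneg (X.shrinkW_nonneg hA k _) (Real.exp_pos _).le
    calc X.shrinkW A k (c.rep o.1) * Real.exp (-(Real.pi * (n : ℝ) ^ 2 * X.profileExcPlus (c.rep o.1) xm)) *
          ‖c.lam o.1 0 * c.lam o.1 1 * conj (c.lam o.1 2 * c.lam o.1 3)‖
        ≤ X.shrinkW A k (c.rep o.1) * Real.exp (-(Real.pi * (n : ℝ) ^ 2 * X.profileExcPlus (c.rep o.1) xm)) * Λ₀ :=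
          mul_le_mul_of_nonneg_left h1 h2
      _ = X.shrinkW A k (c.rep o.1) * Λ₀ * Real.exp (-(Real.pi * (n : ℝ) ^ 2 * X.profileExcPlus (c.rep o.1) xm)) := by
          ring
  have hW0 : ∀ o, 0 ≤ W o := fun o => mul_nonneg (X.shrinkMaj_nonneg hA k _ _) (norm_nonneg _)
  -- the count over the subtype of non-main copies
  have hf : Summable fun o : X.NonMainCopies S (X.rayCentre xm n) => W o.1 :=
    Summable.of_nonneg_of_le (fun o => hW0 o.1) hle (hg.comp_injective c.nnRep_injective)
  -- the `ite` sum is the sum over the subtype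
  have hind : (∑' o, if o ∈ X.Copies S (X.rayCentre xm n) ∧ o ≠ X.orbitOf (X.lines (X.rayCentre xm n)) then
      X.shrinkMaj A k (c.rep o) (X.rayCentre xm n) * ‖c.lam o 0 * c.lam o 1 * conj (c.lam o 2 * c.lam o 3)‖ else 0) =
      ∑' o : X.NonMainCopies S (X.rayCentre xm n), W o.1 := by
    rw [tsum_subtype]
    refine tsum_congr fun o => ?_
    simp only [Set.indicator_apply, NonMainCopies, Set.mem_setOf_eq, hW]
  rw [hind]
  unfold gaussCount
  exact hf.tsum_le_tsum_of_inj c.nnRep c.nnRep_injective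
    (fun ε _ => mul_nonneg (hw0 ε) (Real.exp_pos _).le) hle hg

/-- **THE PURE COUNT ALONG THE RAY, UNDER THE STRICT PROFILE CONDITION**: for every `θ > 0`, from some scale on the count
over the copies of `n • xm` with the majorant `shrinkMaj A k (rep o) (n • xm) · ‖Λ(o)‖` is summable and `≤ θ` — both
conjuncts of `MajorantCount S (n • xm) (c_n.majHK A k) θ` (bus S13913). -/
theorem eventually_copyCount_rayCentre {D : X.ThetaData} {S : Set (Fin 4 → X.E)} (hS : X.IntegralScalars S)
    {xm : X.Tuple} (hx : ∀ j, xm j ≠ 0) (c : ∀ n : ℕ, X.CopyData D S (X.rayCentre xm n)) {A k : ℝ} (hA : 0 ≤ A)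
    (hk : 0 ≤ k) {Λ₀ : ℝ} (hΛ0 : 0 ≤ Λ₀)
    (hΛ : ∀ n, ∀ o ∈ X.Copies S (X.rayCentre xm n),
      ‖(c n).lam o 0 * (c n).lam o 1 * conj ((c n).lam o 2 * (c n).lam o 3)‖ ≤ Λ₀)
    (hprof : ∀ ε ∈ X.NonNormOne S, 0 < X.profileExcPlus ε xm) {θ : ℝ} (hθ : 0 < θ) :
    ∀ᶠ n : ℕ in atTop,
      (Summable fun o => if o ∈ X.Copies S (X.rayCentre xm n) ∧ o ≠ X.orbitOf (X.lines (X.rayCentre xm n)) then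
        X.shrinkMaj A k ((c n).rep o) (X.rayCentre xm n) *
          ‖(c n).lam o 0 * (c n).lam o 1 * conj ((c n).lam o 2 * (c n).lam o 3)‖ else 0) ∧
      (∑' o, if o ∈ X.Copies S (X.rayCentre xm n) ∧ o ≠ X.orbitOf (X.lines (X.rayCentre xm n)) then
        X.shrinkMaj A k ((c n).rep o) (X.rayCentre xm n) *
          ‖(c n).lam o 0 * (c n).lam o 1 * conj ((c n).lam o 2 * (c n).lam o 3)‖ else 0) ≤ θ := by
  have hbase := X.summable_base_count hS hx hA hk hΛ0 (S := S)
  have hw0 : ∀ ε : X.NonNormOne S, 0 ≤ X.shrinkW A k ε.1 * Λ₀ := fun ε => mul_nonneg (X.shrinkW_nonneg hA k _) hΛ0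
  have hE : ∀ ε : X.NonNormOne S, 0 < X.profileExcPlus ε.1 xm := fun ε => hprof ε.1 ε.2
  have htail := eventually_tsum_gauss_ray_le hw0 hE hbase hθ
  filter_upwards [htail, Filter.eventually_ge_atTop 1] with n hn hn1
  refine ⟨X.summable_copyCount_shrinkMaj hS (X.rayCentre_ne_zero hx hn1) (c n) hA hk (hΛ n), ?_⟩
  exact (X.copyCount_rayCentre_le hS hx hn1 (c n) hA hk hΛ0 (hΛ n) fun ε hε => (hprof ε hε).le).trans hn

end T4Data

end Summit.Ventures.HodgeRepro.Tier4.Line3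

end
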